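import Literature.Analysis.FluidPDE.VeryWeakToDistributional
import Literature.Analysis.FluidPDE.HessianLaplacianLpGeneralProofs
import HarnessLib

/-!
# Very weak `L^q` solutions: the pressure-free control of the very weak functional (core)

Analysis/FluidPDE proofs file (theorems only: no definitions, no named facts) on the discharge
path of `Literature.Analysis.FluidPDE.chae2007_asymptoticallySelfSimilar_local` (D. Chae, Math. Ann.
338 (2007), Thm 1.5; the profile conclusion `V̄ = 0` for `3 < p < ∞`). For a very weak
(divergence-free tested, pressure-free) solution `u` of Navier–Stokes on a slab `(0, S) × ℝ³` with
`u, |u|² ∈ L¹_loc`, `∫∫_Q |u|^r < ∞` and slices bounded in `L^r`, `2 < r < ∞`, this file bounds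
the very weak functional `W(ψ) = ∫∫ ⟪u, ∂ₜψ⟫ + ⟪u, (u·∇)ψ⟫ + ν⟪u, Δψ⟫` on a GENERAL (not
divergence-free) test field `ψ` by the size of `div ψ` **without introducing a pressure**
(Lemarié-Rieusset 2016, Ch. 6, proof of Prop. 6.5 / (6.13), with the compactly supported corrector
of `VeryWeakToDistributional.lean`): testing with the divergence-free corrected field
`w_r = ψ − ∇N_r[div ψ] − e_r[ψ]` (`correctedTestField`) gives
`W(ψ) = ∫∫ D²N_r[div ψ](u, u) + W(e_r[ψ])`; the second term is `o(1)` as `r → ∞`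
(`tendsto_setIntegral_veryWeakIntegrand_farSmoothingField_rpow`, the `L^r` version of the tree's
`L³` lemma), and the first is bounded, uniformly in the truncation radius `r`, by the
Calderón–Zygmund bound for the Hessian of the truncated Newtonian potential
(`stein1970_hessian_Lp_bound_holds`, Stein 1970, Ch. III §1.3 Prop. 3, PROVED in the tree) and
Hölder: `|W(ψ)| ≤ 9 C S M² sup_t ‖div ψ(t)‖_{L^{s'}}`, `s = r/2`
(`abs_setIntegral_veryWeakIntegrand_le`). The companion `VeryWeakLqMild.lean` feeds this bound
into the Fabes–Jones–Rivière argument of `DistributionalL3Mild.lean` to obtain the mild (duality)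
formulation for very weak solutions in `C_t L^q`, `q > 2`, with no pressure hypothesis.

* `opNorm_le_sum_single` — `‖T‖ ≤ Σᵢ ‖T eᵢ‖` for a continuous linear map on `ℝ³`;
* `abs_hessian_apply_le` — `|D²θ(x)(v, v)| ≤ ‖v‖² Σᵢⱼ |∂ⱼ∂ᵢθ(x)|`;
* `setIntegral_veryWeakIntegrand_gradient_eq` — for weakly divergence-free `u`,
  `W(∇θ) = ∫∫ D²θ(u, u)` (`∂ₜ∇θ = ∇∂ₜθ`, `Δ∇θ = ∇Δθ` pair to zero);
* `tendsto_setIntegral_veryWeakIntegrand_farSmoothingField_rpow` — `W(e_r[ψ]) → 0`;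
* `abs_setIntegral_hessian_le` — the Hölder–Calderón–Zygmund bound of `∫∫ D²N_r[g](u, u)`;
* `abs_setIntegral_veryWeakIntegrand_le` — **the bound of `W(ψ)` by `div ψ`**.

## References

* P. G. Lemarié-Rieusset, *The Navier–Stokes Problem in the 21st Century* (2016), Ch. 6,
  Prop. 6.5 and (6.13) [LemarieRieusset2016].
* E. M. Stein, *Singular integrals and differentiability properties of functions* (1970),
  Ch. III §1.3 Prop. 3 [Stein1971].
* E. B. Fabes, B. F. Jones, N. M. Rivière, Arch. Rational Mech. Anal. 45 (1972) 222–240, §2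
  [FabesJonesRiviere1972].
-/

noncomputable section

open _root_.MeasureTheory Set Function Filter Metric TopologicalSpace InnerProductSpace
open scoped NNReal ENNReal _root_.Topology RealInnerProductSpace Laplacian ContDiff

namespace Literature.Analysis.FluidPDE

namespace VeryWeakLqMild

/-- Local notation for physical space `ℝ³ = EuclideanSpace ℝ (Fin 3)`. -/
local notation "ℝ³" => EuclideanSpace ℝ (Fin 3)

/-! ### Operator norms through the standard basis; the Hessian applied twice -/

section OpNorm

/-- The standard basis vectors of `ℝ³` have norm one. [folklore] -/
theorem norm_single_one (i : Fin 3) : ‖(EuclideanSpace.single i (1 : ℝ) : ℝ³)‖ = 1 := by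
  simp

/-- Coordinates are bounded by the norm: `|v i| ≤ ‖v‖`. [folklore] -/
theorem abs_apply_le_norm (v : ℝ³) (i : Fin 3) : |v i| ≤ ‖v‖ := by
  have h := abs_real_inner_le_norm (EuclideanSpace.single i (1 : ℝ) : ℝ³) v
  rw [EuclideanSpace.inner_single_left, norm_single_one, one_mul] at h
  simpa using h

/-- **Operator norm through the standard basis**: for a continuous linear map `T` on `ℝ³`,
`‖T‖ ≤ Σᵢ ‖T eᵢ‖`. [folklore] -/
theorem opNorm_le_sum_single {F : Type*} [NormedAddCommGroup F] [NormedSpace ℝ F]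
    (T : ℝ³ →L[ℝ] F) : ‖T‖ ≤ ∑ i, ‖T (EuclideanSpace.single i (1 : ℝ))‖ := by
  refine ContinuousLinearMap.opNorm_le_bound _ (by positivity) fun v => ?_
  have hv : ∑ i, v i • (EuclideanSpace.single i (1 : ℝ) : ℝ³) = v := by
    simpa using (EuclideanSpace.basisFun (Fin 3) ℝ).sum_repr v
  calc ‖T v‖ = ‖∑ i, v i • T (EuclideanSpace.single i (1 : ℝ))‖ := by
        conv_lhs => rw [← hv]
        simp [map_sum, map_smul]
    _ ≤ ∑ i, ‖v i • T (EuclideanSpace.single i (1 : ℝ))‖ := norm_sum_le _ _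
    _ ≤ ∑ i, ‖v‖ * ‖T (EuclideanSpace.single i (1 : ℝ))‖ := by
        refine Finset.sum_le_sum fun i _ => ?_
        rw [norm_smul]
        exact mul_le_mul_of_nonneg_right (by simpa using abs_apply_le_norm v i) (norm_nonneg _)
    _ = (∑ i, ‖T (EuclideanSpace.single i (1 : ℝ))‖) * ‖v‖ := by
        rw [Finset.sum_mul]; refine Finset.sum_congr rfl fun i _ => ?_; ring

/-- **The Hessian applied twice is controlled by its entries**: for `θ ∈ C²` and `v ∈ ℝ³`,
`|D²θ(x)(v, v)| ≤ ‖v‖² Σⱼ Σᵢ |∂ⱼ∂ᵢθ(x)|`, where `∂ⱼ∂ᵢθ(x) = D(D θ · eᵢ)(x) eⱼ`. [folklore] -/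
theorem abs_hessian_apply_le {θ : ℝ³ → ℝ} (hθ : ContDiff ℝ 2 θ) (x v : ℝ³) :
    |fderiv ℝ (fderiv ℝ θ) x v v| ≤ ‖v‖ ^ 2 * ∑ j, ∑ i,
      |fderiv ℝ (fun y => fderiv ℝ θ y (EuclideanSpace.single i (1 : ℝ))) x
        (EuclideanSpace.single j (1 : ℝ))| := by
  set L : ℝ³ →L[ℝ] ℝ³ →L[ℝ] ℝ := fderiv ℝ (fderiv ℝ θ) x with hL
  have hdiff : DifferentiableAt ℝ (fderiv ℝ θ) x :=
    ((hθ.fderiv_right (m := 1) (by norm_cast)).differentiable one_ne_zero) x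
  -- the entries
  have hentry : ∀ i j, L (EuclideanSpace.single j (1 : ℝ)) (EuclideanSpace.single i (1 : ℝ)) =
      fderiv ℝ (fun y => fderiv ℝ θ y (EuclideanSpace.single i (1 : ℝ))) x
        (EuclideanSpace.single j (1 : ℝ)) := by
    intro i j
    rw [fderiv_clm_apply hdiff (differentiableAt_const _), fderiv_fun_const]
    simp [hL]
  have h1 : |L v v| ≤ ‖L‖ * ‖v‖ * ‖v‖ := by
    rw [← Real.norm_eq_abs]; exact L.le_opNorm₂ v v
  have h2 : ‖L‖ ≤ ∑ j, ∑ i, |fderiv ℝ (fun y => fderiv ℝ θ y (EuclideanSpace.single i (1 : ℝ))) x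
      (EuclideanSpace.single j (1 : ℝ))| := by
    refine (opNorm_le_sum_single L).trans (Finset.sum_le_sum fun j _ => ?_)
    refine (opNorm_le_sum_single (L (EuclideanSpace.single j (1 : ℝ)))).trans
      (Finset.sum_le_sum fun i _ => ?_)
    rw [Real.norm_eq_abs, hentry]
  calc |L v v| ≤ ‖L‖ * ‖v‖ * ‖v‖ := h1
    _ = ‖v‖ ^ 2 * ‖L‖ := by ring
    _ ≤ _ := mul_le_mul_of_nonneg_left h2 (sq_nonneg _)

end OpNorm

/-! ### The very weak integrand against a gradient: no pressure needed -/

section Gradient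

variable {Q : Opens (ℝ × ℝ³)} {ν : ℝ} {u : ℝ → ℝ³ → ℝ³}

/-- **The very weak integrand against a gradient test field** `∇θ`, `θ ∈ C_c^∞(Q)`, for a weakly
divergence-free `u`: `∫∫_Q W(∇θ) = ∫∫_Q D²θ(u, u)` (`∂ₜ∇θ = ∇∂ₜθ` and `Δ∇θ = ∇Δθ` pair to zero
with `u`; `⟪u, (u·∇)∇θ⟫ = D²θ(u, u)`) — the first half of the tree's
`setIntegral_veryWeakIntegrand_gradient`, which needs no pressure. [folklore] -/
theorem setIntegral_veryWeakIntegrand_gradient_eq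
    (hu1 : LocallyIntegrableOn (uncurry u) (Q : Set (ℝ × ℝ³)) volume)
    (hu2 : LocallyIntegrableOn (fun z => ‖uncurry u z‖ ^ 2) (Q : Set (ℝ × ℝ³)) volume)
    (hdiv : ∀ θ : ℝ → ℝ³ → ℝ, IsSpaceTimeTestOn Q θ →
      ∫ z in (Q : Set (ℝ × ℝ³)), ⟪u z.1 z.2, gradient (θ z.1) z.2⟫ = 0)
    {θ : ℝ → ℝ³ → ℝ} (hθ : IsSpaceTimeTestOn Q θ) :
    ∫ z in (Q : Set (ℝ × ℝ³)), veryWeakIntegrand ν u (fun t x => gradient (θ t) x) z =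
      ∫ z in (Q : Set (ℝ × ℝ³)), fderiv ℝ (fderiv ℝ (θ z.1)) z.2 (u z.1 z.2) (u z.1 z.2) := by
  have hψ := hθ.gradient_isSpaceTimeTestOn
  have h1 := hθ.timeDeriv_isSpaceTimeTestOn
  have h2 := hθ.laplacian_isSpaceTimeTestOn
  have hθ2 : ∀ t, ContDiff ℝ 2 (θ t) := fun t => (hθ.contDiff_slice t).of_le (by norm_cast)
  have hθ3 : ∀ t, ContDiff ℝ 3 (θ t) := fun t => (hθ.contDiff_slice t).of_le (by norm_cast)
  have hpt : ∀ z : ℝ × ℝ³, veryWeakIntegrand ν u (fun t x => gradient (θ t) x) z =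
      fderiv ℝ (fderiv ℝ (θ z.1)) z.2 (u z.1 z.2) (u z.1 z.2) +
        (⟪u z.1 z.2, gradient (timeDeriv θ z.1) z.2⟫ +
          ν * ⟪u z.1 z.2, gradient (fun y => Δ (θ z.1) y) z.2⟫) := by
    rintro ⟨t, x⟩
    rw [veryWeakIntegrand_apply]
    have e1 : timeDeriv (fun s y => gradient (θ s) y) t x = gradient (timeDeriv θ t) x :=
      hθ.timeDeriv_gradient t x
    have e2 : convect (u t) (fun y => gradient (θ t) y) x = fderiv ℝ (gradient (θ t)) x (u t x) :=
      rfl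
    have e3 : Δ (fun y => gradient (θ t) y) x = gradient (fun y => Δ (θ t) y) x :=
      laplacian_gradient (hθ3 t) x
    simp only
    rw [e1, e2, inner_fderiv_gradient_apply (hθ2 t), e3]
    ring
  simp_rw [hpt]
  obtain ⟨c1, -, z1⟩ := h1.continuous_gradient_field
  obtain ⟨c2, -, z2⟩ := h2.continuous_gradient_field
  have I1 : Integrable (fun z : ℝ × ℝ³ => ⟪u z.1 z.2, gradient (timeDeriv θ z.1) z.2⟫)
      (volume : Measure (ℝ × ℝ³)) :=
    integrable_inner_of_locallyIntegrableOn hu1 c1 h1.hasCompactSupport h1.tsupport_subset z1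
  have I2 : Integrable (fun z : ℝ × ℝ³ => ⟪u z.1 z.2, gradient (fun y => Δ (θ z.1) y) z.2⟫)
      (volume : Measure (ℝ × ℝ³)) :=
    integrable_inner_of_locallyIntegrableOn hu1 c2 h2.hasCompactSupport h2.tsupport_subset z2
  have I12 : Integrable (fun z : ℝ × ℝ³ => ⟪u z.1 z.2, gradient (timeDeriv θ z.1) z.2⟫ +
      ν * ⟪u z.1 z.2, gradient (fun y => Δ (θ z.1) y) z.2⟫)
      ((volume : Measure (ℝ × ℝ³)).restrict (Q : Set (ℝ × ℝ³))) :=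
    I1.integrableOn.add (I2.integrableOn.const_mul ν)
  have hzero : ∫ z in (Q : Set (ℝ × ℝ³)), (⟪u z.1 z.2, gradient (timeDeriv θ z.1) z.2⟫ +
      ν * ⟪u z.1 z.2, gradient (fun y => Δ (θ z.1) y) z.2⟫) = 0 := by
    rw [integral_add I1.integrableOn (I2.integrableOn.const_mul ν), integral_const_mul, hdiv _ h1,
      hdiv _ h2]
    ring
  obtain ⟨-, Ic, -⟩ := integrable_veryWeak_terms hu1 hu2 hψ ν
  have Ic' : Integrable (fun z : ℝ × ℝ³ => fderiv ℝ (fderiv ℝ (θ z.1)) z.2 (u z.1 z.2) (u z.1 z.2))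
      (volume : Measure (ℝ × ℝ³)) := by
    refine Ic.congr (Eventually.of_forall fun z => ?_)
    exact inner_fderiv_gradient_apply (hθ2 z.1) z.2 (u z.1 z.2)
  rw [integral_add Ic'.integrableOn I12, hzero, add_zero]

end Gradient

/-! ### The corrector remainder `W(e_r[ψ])` vanishes as `r → ∞` (`L^r` version) -/

section Remainder

variable {S ν : ℝ} {u : ℝ → ℝ³ → ℝ³}

/-- `‖ |u|² ‖ₑ ^ (r/2) = ‖u‖ₑ ^ r`. [folklore] -/
theorem enorm_norm_sq_rpow_half (v : ℝ³) (r : ℝ) :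
    ‖(‖v‖ ^ 2 : ℝ)‖ₑ ^ (r / 2) = ‖v‖ₑ ^ r := by
  rw [Real.enorm_eq_ofReal (sq_nonneg _), ENNReal.ofReal_pow (norm_nonneg _), ofReal_norm,
    ← ENNReal.rpow_natCast, ← ENNReal.rpow_mul]
  congr 1
  push_cast
  ring

/-- **Terms B, C, D: the very weak integrand against the corrector `e_r[ψ]` vanishes as `r → ∞`**
for `∫∫_Q |u|^r < ∞`, `2 < r < ∞` (the tree's `tendsto_setIntegral_veryWeakIntegrand_farSmoothingField`
is the case `r = 3`: `∂ₜe_r = e_r[∂ₜψ]`, `Δe_r = e_r[Δψ]` are `O(r⁻³)` and the convective pairing is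
`|u|² O(r⁻³)`, all on a box of volume `O(r³)`, and Hölder with exponents `(r, r')`, `(r/2, (r/2)')`
gives decay `r^{-3/r}`, `r^{-6/r}`). [folklore] -/
theorem tendsto_setIntegral_veryWeakIntegrand_farSmoothingField_rpow (hS : 0 < S) {r : ℝ}
    (hr : 2 < r)
    (hu1 : LocallyIntegrableOn (uncurry u)
      ((slab ℝ³ (Ioo 0 S) isOpen_Ioo : Opens (ℝ × ℝ³)) : Set (ℝ × ℝ³)) volume)
    (hu2 : LocallyIntegrableOn (fun z => ‖uncurry u z‖ ^ 2)
      ((slab ℝ³ (Ioo 0 S) isOpen_Ioo : Opens (ℝ × ℝ³)) : Set (ℝ × ℝ³)) volume)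
    (hum : AEStronglyMeasurable (uncurry u) (volume.restrict (Ioo 0 S ×ˢ (univ : Set ℝ³))))
    (hur : ∫⁻ z in Ioo 0 S ×ˢ (univ : Set ℝ³), ‖uncurry u z‖ₑ ^ r < ⊤)
    {ψ : ℝ → ℝ³ → ℝ³} (hψ : IsSpaceTimeTestOn (slab ℝ³ (Ioo 0 S) isOpen_Ioo) ψ) (ν : ℝ) :
    Tendsto (fun ρ => ∫ z in Ioo 0 S ×ˢ (univ : Set ℝ³),
      veryWeakIntegrand ν u (fun t x => farSmoothingField (ρ / 2) ρ (ψ t) x) z) atTop (𝓝 0) := by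
  obtain ⟨a, b, R₀, -, -, hR₀, hT⟩ := hψ.exists_tsupport_subset_box hS
  have hψ' : IsSpaceTimeTestOn (⊤ : Opens (ℝ × ℝ³)) ψ := hψ.mono le_top
  have hr1 : 1 < r := by linarith
  have hrr' : r.HolderConjugate (Real.conjExponent r) := Real.HolderConjugate.conjExponent hr1
  have hss' : (r / 2).HolderConjugate (Real.conjExponent (r / 2)) :=
    Real.HolderConjugate.conjExponent (by linarith)
  have humE : AEMeasurable (fun z => ‖uncurry u z‖ₑ) (volume.restrict (Ioo 0 S ×ˢ (univ : Set ℝ³))) :=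
    hum.aemeasurable.enorm
  have hu2mE : AEMeasurable (fun z => ‖(‖uncurry u z‖ ^ 2 : ℝ)‖ₑ)
      (volume.restrict (Ioo 0 S ×ˢ (univ : Set ℝ³))) :=
    (hum.norm.pow 2).aemeasurable.enorm
  have hu2r : ∫⁻ z in Ioo 0 S ×ˢ (univ : Set ℝ³), ‖(‖uncurry u z‖ ^ 2 : ℝ)‖ₑ ^ (r / 2) < ⊤ := by
    simp only [enorm_norm_sq_rpow_half]
    exact hur
  -- the derived test fields and their supports
  have hdt := hψ'.timeDeriv_top
  have hlap := hψ'.laplacian_top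
  have hdt0 : ∀ t y, (t, y) ∉ Icc a b ×ˢ closedBall (0 : ℝ³) R₀ → timeDeriv ψ t y = 0 :=
    fun t y hty => IsSpaceTimeTestOn.timeDeriv_eq_zero_of_notMem (ψ := ψ) fun h => hty (hT h)
  have hlap0 : ∀ t y, (t, y) ∉ Icc a b ×ˢ closedBall (0 : ℝ³) R₀ → Δ (ψ t) y = 0 :=
    fun t y hty => laplacian_slice_eq_zero_of_notMem_tsupport fun h => hty (hT h)
  obtain ⟨C₁, hC₁0, hC₁⟩ := exists_norm_farSmoothingField_slice_le hdt
  obtain ⟨C₂, hC₂0, hC₂⟩ := exists_abs_inner_fderiv_farSmoothingField_le hψ'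
  obtain ⟨C₃, hC₃0, hC₃⟩ := exists_norm_farSmoothingField_slice_le hlap
  -- the three limits
  have hB : Tendsto (fun ρ => ∫ z in Ioo 0 S ×ˢ (univ : Set ℝ³),
      ⟪u z.1 z.2, timeDeriv (fun t x => farSmoothingField (ρ / 2) ρ (ψ t) x) z.1 z.2⟫) atTop (𝓝 0) := by
    refine tendsto_setIntegral_slab_of_bound (F := uncurry u) (r₁ := 1) (a := a) (b := b) (C := C₁)
      hrr' humE hur hR₀ (fun ρ hρ z _ => ?_) (fun ρ hρ z hz => ?_)
    · have hρ0 : 0 < ρ := one_pos.trans_le hρ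
      rw [timeDeriv_farSmoothingField (half_pos hρ0) (half_lt_self hρ0) hψ']
      exact (norm_inner_le_norm _ _).trans (mul_le_mul_of_nonneg_left (hC₁ hρ0 _ _) (norm_nonneg _))
    · have hρ0 : 0 < ρ := one_pos.trans_le hρ
      rw [timeDeriv_farSmoothingField (half_pos hρ0) (half_lt_self hρ0) hψ',
        farSmoothingField_slice_eq_zero_of_notMem hdt0 hρ0 hz, inner_zero_right]
  have hC : Tendsto (fun ρ => ∫ z in Ioo 0 S ×ˢ (univ : Set ℝ³),
      ⟪u z.1 z.2, convect (u z.1) (fun x => farSmoothingField (ρ / 2) ρ (ψ z.1) x) z.2⟫)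
      atTop (𝓝 0) := by
    refine tendsto_setIntegral_slab_of_bound (F := fun z => ‖uncurry u z‖ ^ 2) (r₁ := 1) (a := a)
      (b := b) (C := C₂) hss' hu2mE hu2r hR₀ (fun ρ hρ z _ => ?_) (fun ρ hρ z hz => ?_)
    · have hρ0 : 0 < ρ := one_pos.trans_le hρ
      rw [convect, Real.norm_eq_abs]
      refine (hC₂ hρ0 z.1 z.2 (u z.1 z.2)).trans (le_of_eq ?_)
      simp [uncurry]
    · have hρ0 : 0 < ρ := one_pos.trans_le hρ
      exact inner_fderiv_farSmoothingField_eq_zero_of_notMem hψ' hT hρ0 hz _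
  have hD : Tendsto (fun ρ => ∫ z in Ioo 0 S ×ˢ (univ : Set ℝ³),
      ν * ⟪u z.1 z.2, Δ (fun x => farSmoothingField (ρ / 2) ρ (ψ z.1) x) z.2⟫) atTop (𝓝 0) := by
    refine tendsto_setIntegral_slab_of_bound (F := uncurry u) (r₁ := 1) (a := a) (b := b)
      (C := |ν| * C₃) hrr' humE hur hR₀ (fun ρ hρ z _ => ?_) (fun ρ hρ z hz => ?_)
    · have hρ0 : 0 < ρ := one_pos.trans_le hρ
      have hψ2 : ContDiff ℝ 2 (ψ z.1) := (hψ.contDiff_slice z.1).of_le (by norm_cast)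
      rw [show (fun x => farSmoothingField (ρ / 2) ρ (ψ z.1) x) = farSmoothingField (ρ / 2) ρ (ψ z.1)
        from rfl, laplacian_farSmoothingField (half_pos hρ0) (half_lt_self hρ0) hψ2, norm_mul,
        Real.norm_eq_abs, mul_div_assoc, mul_left_comm]
      refine mul_le_mul_of_nonneg_left ?_ (abs_nonneg _)
      exact (norm_inner_le_norm _ _).trans (mul_le_mul_of_nonneg_left (hC₃ hρ0 _ _) (norm_nonneg _))
    · have hρ0 : 0 < ρ := one_pos.trans_le hρ
      have hψ2 : ContDiff ℝ 2 (ψ z.1) := (hψ.contDiff_slice z.1).of_le (by norm_cast)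
      rw [show (fun x => farSmoothingField (ρ / 2) ρ (ψ z.1) x) = farSmoothingField (ρ / 2) ρ (ψ z.1)
        from rfl, laplacian_farSmoothingField (half_pos hρ0) (half_lt_self hρ0) hψ2,
        farSmoothingField_slice_eq_zero_of_notMem hlap0 hρ0 hz, inner_zero_right, mul_zero]
  -- assembling: for `ρ > 0` the integral splits
  have hsum := (hB.add hC).add hD
  rw [add_zero, add_zero] at hsum
  refine hsum.congr' ?_
  filter_upwards [eventually_gt_atTop 0] with ρ hρ
  have he := isSpaceTimeTestOn_farSmoothingField_slab hS hψ (half_pos hρ) (half_lt_self hρ)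
  obtain ⟨I1, I2, I3⟩ := integrable_veryWeak_terms hu1 hu2 he ν
  simp only [veryWeakIntegrand_apply]
  rw [integral_add (f := fun z : ℝ × ℝ³ =>
      ⟪u z.1 z.2, timeDeriv (fun t x => farSmoothingField (ρ / 2) ρ (ψ t) x) z.1 z.2⟫ +
        ⟪u z.1 z.2, convect (u z.1) (fun x => farSmoothingField (ρ / 2) ρ (ψ z.1) x) z.2⟫)
      (g := fun z : ℝ × ℝ³ => ν * ⟪u z.1 z.2, Δ (fun x => farSmoothingField (ρ / 2) ρ (ψ z.1) x) z.2⟫)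
      (I1.integrableOn.add I2.integrableOn) I3.integrableOn,
    integral_add I1.integrableOn I2.integrableOn]

end Remainder

/-! ### The Hölder–Calderón–Zygmund bound of the Hessian term, and the bound of `W(ψ)` -/

section Bound

variable {S ν : ℝ} {u : ℝ → ℝ³ → ℝ³}

/-- The spatial directional derivatives of a space–time test function on `Q` are space–time test
functions on `Q` (copy of the tree's `IsSpaceTimeTestOn.fderiv_apply_slice`, kept local to keep
the import closure small). [folklore] -/
theorem isSpaceTimeTestOn_fderiv_apply_slice {Q : Opens (ℝ × ℝ³)} {θ : ℝ → ℝ³ → ℝ}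
    (hθ : IsSpaceTimeTestOn Q θ) (v : ℝ³) :
    IsSpaceTimeTestOn Q (fun t y => fderiv ℝ (θ t) y v) := by
  have htop := (hθ.mono le_top).fderiv_apply_top v
  refine ⟨htop.contDiff, htop.hasCompactSupport, ?_⟩
  refine (closure_minimal ?_ (isClosed_tsupport _)).trans hθ.tsupport_subset
  intro z hz
  by_contra hzs
  apply hz
  show fderiv ℝ (θ z.1) z.2 v = 0
  rw [IsSpaceTimeTestOn.fderiv_slice_eq_zero_of_notMem hzs]
  rfl

/-- `(|v|²)^{r/2} = |v|^r` for real powers. [folklore] -/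
theorem norm_sq_rpow_half (v : ℝ³) (r : ℝ) : (‖v‖ ^ 2 : ℝ) ^ (r / 2) = ‖v‖ ^ r := by
  rw [← Real.rpow_natCast, ← Real.rpow_mul (norm_nonneg _)]
  congr 1
  push_cast
  ring

/-- **Hölder for the Hessian entries against `|u|²` on a slice**: for `2 < r`, `s = r/2`,
`s'` its conjugate, `H ∈ L^{s'}` continuous with compact support and `u(t) ∈ L^r`,
`∫ |H| |u(t)|² ≤ ‖H‖_{L^{s'}} (∫ |u(t)|^r)^{2/r}`. [folklore] -/
theorem integral_abs_mul_norm_sq_le {r : ℝ} (hr : 2 < r) {H : ℝ³ → ℝ} (hHc : Continuous H)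
    (hHs : HasCompactSupport H) {w : ℝ³ → ℝ³} (hw : MemLp w (ENNReal.ofReal r) volume) :
    ∫ x, |H x| * ‖w x‖ ^ 2 ≤
      (eLpNorm H (ENNReal.ofReal (Real.conjExponent (r / 2))) volume).toReal *
        (∫ x, ‖w x‖ ^ r) ^ (2 / r) := by
  set s : ℝ := r / 2 with hs
  have hs1 : 1 < s := by rw [hs]; linarith
  set s' : ℝ := Real.conjExponent s with hs'
  have hss' : s.HolderConjugate s' := Real.HolderConjugate.conjExponent hs1
  have hs'pos : 0 < s' := hss'.symm.pos
  -- the two `MemLp` classes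
  have hf : MemLp (fun x => |H x|) (ENNReal.ofReal s') volume :=
    (continuous_abs.comp hHc).memLp_of_hasCompactSupport (hHs.comp_left abs_zero)
  have hg : MemLp (fun x => ‖w x‖ ^ 2) (ENNReal.ofReal s) volume := by
    have h := hw.norm_rpow_div (2 : ℝ≥0∞)
    have e1 : ENNReal.ofReal r / 2 = ENNReal.ofReal s := by
      rw [hs, ENNReal.ofReal_div_of_pos two_pos, ENNReal.ofReal_ofNat]
    rw [e1] at h
    refine h.congr_norm ?_ (Eventually.of_forall fun x => ?_)
    · exact (hw.1.norm.pow 2)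
    · simp only [ENNReal.toReal_ofNat, Real.rpow_two, norm_pow, norm_norm]
  have key := integral_mul_le_Lp_mul_Lq_of_nonneg hss'.symm
    (Eventually.of_forall fun x => abs_nonneg (H x))
    (Eventually.of_forall fun x => sq_nonneg ‖w x‖) hf hg
  -- identify the two factors
  have e2 : (∫ x, |H x| ^ s') ^ (1 / s') =
      (eLpNorm H (ENNReal.ofReal s') volume).toReal := by
    have hH : MemLp H (ENNReal.ofReal s') volume := hHc.memLp_of_hasCompactSupport hHs
    rw [hH.eLpNorm_eq_integral_rpow_norm (by simp [hs'pos]) ENNReal.ofReal_ne_top,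
      ENNReal.toReal_ofReal (Real.rpow_nonneg (integral_nonneg fun x => by positivity) _),
      ENNReal.toReal_ofReal hs'pos.le, one_div]
    simp only [Real.norm_eq_abs]
  have e3 : (∫ x, (‖w x‖ ^ 2) ^ s) ^ (1 / s) = (∫ x, ‖w x‖ ^ r) ^ (2 / r) := by
    simp only [hs, norm_sq_rpow_half]
    congr 1
    field_simp
  rw [e2, e3] at key
  exact key

/-- **The Hessian term of a space–time test function is controlled by its entries' `L^{s'}` size**:
for `θ ∈ C_c^∞` of the slab with `‖∂ⱼ∂ᵢθ(t)‖_{L^{s'}} ≤ B` for all `t, i, j`, and slices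
`(∫ |u(t)|^r)^{2/r} ≤ M₂` on `(0, S)`, `|∫∫_Q D²θ(u, u)| ≤ 9 B M₂ S`. [folklore] -/
theorem abs_setIntegral_hessian_le (hS : 0 < S) {r : ℝ} (hr : 2 < r)
    (hu2 : LocallyIntegrableOn (fun z => ‖uncurry u z‖ ^ 2)
      ((slab ℝ³ (Ioo 0 S) isOpen_Ioo : Opens (ℝ × ℝ³)) : Set (ℝ × ℝ³)) volume)
    (hmem : ∀ t ∈ Ioo 0 S, MemLp (u t) (ENNReal.ofReal r) volume) {M₂ : ℝ}
    (hM : ∀ t ∈ Ioo 0 S, (∫ x, ‖u t x‖ ^ r) ^ (2 / r) ≤ M₂)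
    {θ : ℝ → ℝ³ → ℝ} (hθ : IsSpaceTimeTestOn (slab ℝ³ (Ioo 0 S) isOpen_Ioo) θ) {B : ℝ} (hB : 0 ≤ B)
    (hH : ∀ t (i j : Fin 3), eLpNorm (fun x => fderiv ℝ (fun y => fderiv ℝ (θ t) y
        (EuclideanSpace.single i (1 : ℝ))) x (EuclideanSpace.single j (1 : ℝ)))
        (ENNReal.ofReal (Real.conjExponent (r / 2))) volume ≤ ENNReal.ofReal B) :
    |∫ z in Ioo 0 S ×ˢ (univ : Set ℝ³), fderiv ℝ (fderiv ℝ (θ z.1)) z.2 (u z.1 z.2) (u z.1 z.2)| ≤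
      9 * B * M₂ * S := by
  set e : Fin 3 → ℝ³ := fun i => EuclideanSpace.single i (1 : ℝ) with he
  -- the entries as space–time test functions on the slab
  set Hf : Fin 3 → Fin 3 → ℝ → ℝ³ → ℝ := fun i j t x =>
    fderiv ℝ (fun y => fderiv ℝ (θ t) y (e i)) x (e j) with hHf
  have hHt : ∀ i j, IsSpaceTimeTestOn (slab ℝ³ (Ioo 0 S) isOpen_Ioo) (Hf i j) := fun i j =>
    isSpaceTimeTestOn_fderiv_apply_slice (isSpaceTimeTestOn_fderiv_apply_slice hθ (e i)) (e j)
  have hθ2 : ∀ t, ContDiff ℝ 2 (θ t) := fun t => (hθ.contDiff_slice t).of_le (by norm_cast)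
  have hQ : ((slab ℝ³ (Ioo 0 S) isOpen_Ioo : Opens (ℝ × ℝ³)) : Set (ℝ × ℝ³)) =
      Ioo 0 S ×ˢ (univ : Set ℝ³) := rfl
  -- integrability of `|H_{ij}| |u|²` on the slab
  have hI : ∀ i j, Integrable (fun z : ℝ × ℝ³ => ‖uncurry u z‖ ^ 2 * |Hf i j z.1 z.2|)
      (volume : Measure (ℝ × ℝ³)) := by
    intro i j
    have hc : Continuous fun z : ℝ × ℝ³ => |Hf i j z.1 z.2| :=
      continuous_abs.comp (hHt i j).contDiff.continuous
    refine integrable_mul_of_locallyIntegrableOn hu2 hc (hHt i j).hasCompactSupport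
      (hHt i j).tsupport_subset fun z hz => ?_
    simp only [abs_eq_zero]
    exact (image_eq_zero_of_notMem_tsupport hz : uncurry (Hf i j) z = 0)
  -- pointwise domination of the Hessian term
  have hdom : ∀ z : ℝ × ℝ³, |fderiv ℝ (fderiv ℝ (θ z.1)) z.2 (u z.1 z.2) (u z.1 z.2)| ≤
      ∑ j, ∑ i, ‖uncurry u z‖ ^ 2 * |Hf i j z.1 z.2| := by
    intro z
    refine (abs_hessian_apply_le (hθ2 z.1) z.2 (u z.1 z.2)).trans (le_of_eq ?_)
    rw [Finset.mul_sum]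
    refine Finset.sum_congr rfl fun j _ => ?_
    rw [Finset.mul_sum]
    rfl
  have hIsum : Integrable (fun z : ℝ × ℝ³ => ∑ j, ∑ i, ‖uncurry u z‖ ^ 2 * |Hf i j z.1 z.2|)
      (volume : Measure (ℝ × ℝ³)) :=
    integrable_finsetSum _ fun j _ => integrable_finsetSum _ fun i _ => hI i j
  -- each entry integral is at most `B M₂ S`
  have hent : ∀ i j, ∫ z in Ioo 0 S ×ˢ (univ : Set ℝ³), ‖uncurry u z‖ ^ 2 * |Hf i j z.1 z.2| ≤
      B * M₂ * S := by
    intro i j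
    have hprod := (hI i j).integrableOn (s := Ioo 0 S ×ˢ (univ : Set ℝ³))
    rw [IntegrableOn, volume_restrict_prod_univ_eq_prod] at hprod
    rw [volume_restrict_prod_univ_eq_prod, integral_prod _ hprod]
    have hslice : ∀ t ∈ Ioo 0 S, ‖∫ x, ‖uncurry u (t, x)‖ ^ 2 * |Hf i j t x|‖ ≤ B * M₂ := by
      intro t ht
      have hc : Continuous (Hf i j t) := (hHt i j).contDiff_slice t |>.continuous
      have hcs : HasCompactSupport (Hf i j t) := (hHt i j).hasCompactSupport_slice t
      have h1 := integral_abs_mul_norm_sq_le hr hc hcs (hmem t ht)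
      have hnn : 0 ≤ ∫ x, ‖uncurry u (t, x)‖ ^ 2 * |Hf i j t x| :=
        integral_nonneg fun x => by positivity
      rw [Real.norm_of_nonneg hnn]
      calc ∫ x, ‖uncurry u (t, x)‖ ^ 2 * |Hf i j t x|
          = ∫ x, |Hf i j t x| * ‖u t x‖ ^ 2 := by
            refine integral_congr_ae (Eventually.of_forall fun x => ?_); simp [uncurry, mul_comm]
        _ ≤ (eLpNorm (Hf i j t) (ENNReal.ofReal (Real.conjExponent (r / 2))) volume).toReal *
              (∫ x, ‖u t x‖ ^ r) ^ (2 / r) := h1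
        _ ≤ B * M₂ := by
            refine mul_le_mul ?_ (hM t ht) (Real.rpow_nonneg (integral_nonneg fun x => by
              positivity) _) hB
            have := hH t i j
            exact (ENNReal.toReal_mono ENNReal.ofReal_ne_top this).trans_eq (ENNReal.toReal_ofReal hB)
    have hvol : (volume : Measure ℝ) (Ioo 0 S) < ⊤ := measure_Ioo_lt_top
    have key := norm_setIntegral_le_of_norm_le_const hvol hslice
    rw [Real.volume_real_Ioo_of_le hS.le, sub_zero] at key
    exact le_trans (le_abs_self _) (le_trans (le_of_eq (Real.norm_eq_abs _).symm) key)
  -- summing up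
  calc |∫ z in Ioo 0 S ×ˢ (univ : Set ℝ³), fderiv ℝ (fderiv ℝ (θ z.1)) z.2 (u z.1 z.2) (u z.1 z.2)|
      ≤ ∫ z in Ioo 0 S ×ˢ (univ : Set ℝ³), ∑ j, ∑ i, ‖uncurry u z‖ ^ 2 * |Hf i j z.1 z.2| := by
        rw [← Real.norm_eq_abs]
        exact norm_integral_le_of_norm_le hIsum.integrableOn
          (Eventually.of_forall fun z => by rw [Real.norm_eq_abs]; exact hdom z)
    _ = ∑ j, ∑ i, ∫ z in Ioo 0 S ×ˢ (univ : Set ℝ³), ‖uncurry u z‖ ^ 2 * |Hf i j z.1 z.2| := by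
        rw [integral_finsetSum _ fun j _ => (integrable_finsetSum _ fun i _ => (hI i j)).integrableOn]
        refine Finset.sum_congr rfl fun j _ => ?_
        rw [integral_finsetSum _ fun i _ => (hI i j).integrableOn]
    _ ≤ ∑ _j : Fin 3, ∑ _i : Fin 3, B * M₂ * S :=
        Finset.sum_le_sum fun j _ => Finset.sum_le_sum fun i _ => hent i j
    _ = 9 * B * M₂ * S := by simp; ring

/-- **The very weak functional is controlled by the divergence of the test field, with no
pressure** (Lemarié-Rieusset 2016, Ch. 6, proof of Prop. 6.5: test with the divergence-free
corrected field `w_r = ψ − ∇N_r[div ψ] − e_r[ψ]` and let `r → ∞`; the Hessian of the truncated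
Newtonian potential is bounded on `L^{s'}` uniformly in `r`, Stein 1970 Ch. III Prop. 3): let
`2 < r`, `u, |u|² ∈ L¹_loc` of the slab with `∫∫|u|^r < ∞`, slices in `L^r` with
`(∫|u(t)|^r)^{2/r} ≤ M₂`, `u` weakly divergence free on the slab and a very weak solution
(`∫∫ W(χ) = 0` for divergence-free test fields `χ`). Then there is `K` (`= 9 C M₂ S`, `C` the
Calderón–Zygmund constant for the exponent `s' = (r/2)'`) such that for every test field `ψ` on
the slab and every `G ≥ 0` with `‖div ψ(t)‖_{L^{s'}} ≤ G` for all `t`, `|∫∫ W(ψ)| ≤ K G`.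
[cite: LemarieRieusset2016, Prop. 6.5 and (6.13)] -/
theorem abs_setIntegral_veryWeakIntegrand_le (hS : 0 < S) {r : ℝ} (hr : 2 < r)
    (hu1 : LocallyIntegrableOn (uncurry u)
      ((slab ℝ³ (Ioo 0 S) isOpen_Ioo : Opens (ℝ × ℝ³)) : Set (ℝ × ℝ³)) volume)
    (hu2 : LocallyIntegrableOn (fun z => ‖uncurry u z‖ ^ 2)
      ((slab ℝ³ (Ioo 0 S) isOpen_Ioo : Opens (ℝ × ℝ³)) : Set (ℝ × ℝ³)) volume)
    (hum : AEStronglyMeasurable (uncurry u) (volume.restrict (Ioo 0 S ×ˢ (univ : Set ℝ³))))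
    (hur : ∫⁻ z in Ioo 0 S ×ˢ (univ : Set ℝ³), ‖uncurry u z‖ₑ ^ r < ⊤)
    (hmem : ∀ t ∈ Ioo 0 S, MemLp (u t) (ENNReal.ofReal r) volume) {M₂ : ℝ} (hM₂ : 0 ≤ M₂)
    (hM : ∀ t ∈ Ioo 0 S, (∫ x, ‖u t x‖ ^ r) ^ (2 / r) ≤ M₂)
    (hdiv : ∀ θ : ℝ → ℝ³ → ℝ, IsSpaceTimeTestOn (slab ℝ³ (Ioo 0 S) isOpen_Ioo) θ →
      ∫ z in Ioo 0 S ×ˢ (univ : Set ℝ³), ⟪u z.1 z.2, gradient (θ z.1) z.2⟫ = 0)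
    (hweak : ∀ χ : ℝ → ℝ³ → ℝ³, IsSpaceTimeTestOn (slab ℝ³ (Ioo 0 S) isOpen_Ioo) χ →
      (∀ t, VectorCalculus.IsDivFree (χ t)) →
      ∫ z in Ioo 0 S ×ˢ (univ : Set ℝ³), veryWeakIntegrand ν u χ z = 0) :
    ∃ K : ℝ, 0 ≤ K ∧ ∀ ⦃ψ : ℝ → ℝ³ → ℝ³⦄, IsSpaceTimeTestOn (slab ℝ³ (Ioo 0 S) isOpen_Ioo) ψ →
      ∀ ⦃G : ℝ⦄, 0 ≤ G →
        (∀ t, eLpNorm (fun x => VectorCalculus.divergence (ψ t) x)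
          (ENNReal.ofReal (Real.conjExponent (r / 2))) volume ≤ ENNReal.ofReal G) →
        |∫ z in Ioo 0 S ×ˢ (univ : Set ℝ³), veryWeakIntegrand ν u ψ z| ≤ K * G := by
  set s' : ℝ := Real.conjExponent (r / 2) with hs'
  have hss' : (r / 2).HolderConjugate s' := Real.HolderConjugate.conjExponent (by linarith)
  have hs'1 : 1 < s' := hss'.symm.lt
  have hp : (1 : ℝ≥0∞) < ENNReal.ofReal s' := by
    rw [← ENNReal.ofReal_one]; exact (ENNReal.ofReal_lt_ofReal_iff (by linarith)).2 hs'1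
  obtain ⟨C, hC⟩ := stein1970_hessian_Lp_bound_holds_fin3.hessian_newtonNearPotential_half hp
    ENNReal.ofReal_lt_top
  have hQ : ((slab ℝ³ (Ioo 0 S) isOpen_Ioo : Opens (ℝ × ℝ³)) : Set (ℝ × ℝ³)) =
      Ioo 0 S ×ˢ (univ : Set ℝ³) := rfl
  refine ⟨9 * C * M₂ * S, by positivity, fun ψ hψ G hG hdivψ => ?_⟩
  -- the corrected field at scale `ρ`
  set g : ℝ → ℝ³ → ℝ := fun t y => VectorCalculus.divergence (ψ t) y with hg
  have hgt : IsSpaceTimeTestOn (slab ℝ³ (Ioo 0 S) isOpen_Ioo) g := hψ.divergence_isSpaceTimeTestOn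
  have hsplit : ∀ ρ : ℝ, 0 < ρ →
      ∫ z in Ioo 0 S ×ˢ (univ : Set ℝ³), veryWeakIntegrand ν u ψ z =
        (∫ z in Ioo 0 S ×ˢ (univ : Set ℝ³),
          fderiv ℝ (fderiv ℝ (newtonNearPotential (ρ / 2) ρ (g z.1))) z.2 (u z.1 z.2) (u z.1 z.2)) +
        ∫ z in Ioo 0 S ×ˢ (univ : Set ℝ³),
          veryWeakIntegrand ν u (fun t x => farSmoothingField (ρ / 2) ρ (ψ t) x) z := by
    intro ρ hρ
    have h₀ : 0 < ρ / 2 := half_pos hρ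
    have h₁ : ρ / 2 < ρ := half_lt_self hρ
    have hθ : IsSpaceTimeTestOn (slab ℝ³ (Ioo 0 S) isOpen_Ioo)
        (fun t => newtonNearPotential (ρ / 2) ρ (g t)) := hgt.newtonNearPotential_slab hS h₀.le h₁
    have hgrad := hθ.gradient_isSpaceTimeTestOn
    have he := isSpaceTimeTestOn_farSmoothingField_slab hS hψ h₀ h₁
    have hw := isSpaceTimeTestOn_correctedTestField hS hψ hρ
    have hwdiv : ∀ t, VectorCalculus.IsDivFree (correctedTestField ρ ψ t) := fun t =>
      isDivFree_correctedTestField hψ hρ t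
    have h0 := hweak _ hw hwdiv
    -- pointwise splitting of the integrand
    have hpt : ∀ z, veryWeakIntegrand ν u (correctedTestField ρ ψ) z =
        veryWeakIntegrand ν u ψ z -
          veryWeakIntegrand ν u (fun t x => gradient (newtonNearPotential (ρ / 2) ρ (g t)) x) z -
          veryWeakIntegrand ν u (fun t x => farSmoothingField (ρ / 2) ρ (ψ t) x) z := by
      intro z
      have e1 : correctedTestField ρ ψ = fun t x =>
          (fun t x => ψ t x - gradient (newtonNearPotential (ρ / 2) ρ (g t)) x) t x -
            farSmoothingField (ρ / 2) ρ (ψ t) x := by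
        funext t x; rfl
      rw [e1, veryWeakIntegrand_sub (hψ.sub hgrad) he, veryWeakIntegrand_sub hψ hgrad]
    have I1 := integrable_veryWeakIntegrand hu1 hu2 hψ ν
    have I2 := integrable_veryWeakIntegrand hu1 hu2 hgrad ν
    have I3 := integrable_veryWeakIntegrand hu1 hu2 he ν
    simp_rw [hpt] at h0
    rw [integral_sub (f := fun z => veryWeakIntegrand ν u ψ z -
        veryWeakIntegrand ν u (fun t x => gradient (newtonNearPotential (ρ / 2) ρ (g t)) x) z)
        (g := fun z => veryWeakIntegrand ν u (fun t x => farSmoothingField (ρ / 2) ρ (ψ t) x) z)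
        (I1.integrableOn.sub I2.integrableOn) I3.integrableOn,
      integral_sub (f := fun z => veryWeakIntegrand ν u ψ z)
        (g := fun z => veryWeakIntegrand ν u
          (fun t x => gradient (newtonNearPotential (ρ / 2) ρ (g t)) x) z)
        I1.integrableOn I2.integrableOn] at h0
    have hG := setIntegral_veryWeakIntegrand_gradient_eq (Q := slab ℝ³ (Ioo 0 S) isOpen_Ioo)
      (ν := ν) hu1 hu2 hdiv hθ
    rw [hQ] at hG
    rw [← hG]
    linarith
  -- the Hessian bound, uniform in `ρ`
  have hHess : ∀ ρ : ℝ, 0 < ρ →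
      |∫ z in Ioo 0 S ×ˢ (univ : Set ℝ³),
        fderiv ℝ (fderiv ℝ (newtonNearPotential (ρ / 2) ρ (g z.1))) z.2 (u z.1 z.2) (u z.1 z.2)| ≤
        9 * (C * G) * M₂ * S := by
    intro ρ hρ
    have hθ : IsSpaceTimeTestOn (slab ℝ³ (Ioo 0 S) isOpen_Ioo)
        (fun t => newtonNearPotential (ρ / 2) ρ (g t)) :=
      hgt.newtonNearPotential_slab hS (half_pos hρ).le (half_lt_self hρ)
    refine abs_setIntegral_hessian_le hS hr hu2 hmem hM hθ (by positivity) fun t i j => ?_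
    have hg2 : ContDiff ℝ 2 (g t) := (hgt.contDiff_slice t).of_le (by norm_cast)
    have hgc : HasCompactSupport (g t) := hgt.hasCompactSupport_slice t
    refine (hC hρ hg2 hgc _ _ (le_of_eq (norm_single_one i)) (le_of_eq (norm_single_one j))).trans ?_
    rw [ENNReal.ofReal_mul (NNReal.coe_nonneg C), ENNReal.ofReal_coe_nnreal]
    exact mul_le_mul' le_rfl (hdivψ t)
  -- letting `ρ → ∞`
  have hlim := tendsto_setIntegral_veryWeakIntegrand_farSmoothingField_rpow hS hr hu1 hu2 hum hur hψ ν
  have hle : ∀ᶠ ρ in atTop, |∫ z in Ioo 0 S ×ˢ (univ : Set ℝ³), veryWeakIntegrand ν u ψ z| ≤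
      9 * (C * G) * M₂ * S + |∫ z in Ioo 0 S ×ˢ (univ : Set ℝ³),
        veryWeakIntegrand ν u (fun t x => farSmoothingField (ρ / 2) ρ (ψ t) x) z| := by
    filter_upwards [eventually_gt_atTop 0] with ρ hρ
    rw [hsplit ρ hρ]
    exact (abs_add_le _ _).trans (add_le_add (hHess ρ hρ) le_rfl)
  have hlim' : Tendsto (fun ρ => 9 * (C * G) * M₂ * S + |∫ z in Ioo 0 S ×ˢ (univ : Set ℝ³),
      veryWeakIntegrand ν u (fun t x => farSmoothingField (ρ / 2) ρ (ψ t) x) z|) atTop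
      (𝓝 (9 * (C * G) * M₂ * S)) := by
    have := (tendsto_const_nhds (x := 9 * (C * G) * M₂ * S)).add hlim.abs
    rwa [abs_zero, add_zero] at this
  have := ge_of_tendsto hlim' hle
  linarith [this]

end Bound

end VeryWeakLqMild

end Literature.Analysis.FluidPDE

end
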